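import Literature.MathematicalPhysics.QuantumFieldTheory.OSDistributionSpaceHolomorphicSemigroupLaw
import HarnessLib

/-!
# Analytic continuation of the Schwinger functions in one time gap (OS I (4.10), OS II (5.4))

Osterwalder–Schrader I (CMP 31 (1973)), §4.1, p. 92, right after the holomorphic semigroup:
"We can use this holomorphic semigroup to construct the analytic continuation of the Euclidean
Green's functions. Let `f_m ∈ 𝒮₊(ℝ^{4m})`, `g_n ∈ 𝒮₊(ℝ^{4n})` … the mapping
`(Θf* × g_n, h) ↦ ∫ (v(f_m), T^{t+is} v(g_n)) h(s) ds` (4.10) defines a continuous linear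
functional … analytic"; Osterwalder–Schrader II (CMP 42 (1975)), Ch. V, eq. (5.4), p. 291:
"`(Ψ_n(x, ξ), e^{-τH} Ψ_m(x', ξ')) = 𝔖_{n+m-1}(−ϑξ, −x + x' + τ, ξ')` defines an analytic
continuation of `𝔖_{n+m-1}` in the `n`'th time variable: … the right hand side of (5.4) is an
analytic function of the variable `z = x⁰ + x⁰' + τ` for `Re z > 0`".

In this tree's vocabulary (`OSDistributionSpace`: generators `p = (n, F)`, `q = (m, G)` with
positive-time test functions, `genPairing 𝔖 p (shiftGen t q) = 𝔖_{n+m}(ΘF* ⊗ G_t)` the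
Schwinger function with the second cluster translated by `t` in time, i.e. evaluated across a
time gap `t`), the statement proved here is:

* `gapContinuation 𝔖 hE1 hE2 p q τ := ⟪v(F), e^{-τH} v(G)⟫` (`holoShiftH`, parts II–III);
* `gapContinuation_ofReal` — for real `t ≥ 0` it **is** the Schwinger function across the gap,
  `𝔖_{n+m}(ΘF* ⊗ G_t)`;
* `differentiableOn_gapContinuation` — **holomorphic in the gap variable on `{Re τ > 0}`**;
  `continuousOn_gapContinuation` — continuous on `{Re τ ≥ 0}`;
  `norm_gapContinuation_le` — **bounded by `‖v(F)‖ ‖v(G)‖`** there (contraction property), the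
  uniform bound that makes the boundary values `τ → is` (real Minkowski time differences) exist.

This is the first, one-variable step (A₀ in one gap) of the analytic continuation behind
`Literature.MathematicalPhysics.QuantumFieldTheory.OS1975_exists_continuation_halfSpace`; the
simultaneous continuation in all time gaps is OS II, Ch. V (Malgrange–Zerner) and is not here.

## References
* K. Osterwalder, R. Schrader, Axioms for Euclidean Green's functions, CMP 31 (1973), §4.1,
  p. 92, eq. (4.10).
* K. Osterwalder, R. Schrader, Axioms for Euclidean Green's functions II, CMP 42 (1975), Ch. V,
  eqs. (5.3)–(5.4), p. 291.
-/

noncomputable section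

open MeasureTheory Set Filter
open _root_.Topology
open scoped InnerProductSpace NNReal ComplexConjugate

-- CFC instance chain on `ℋ →L[ℂ] ℋ` (see `OSDistributionSpacePowers`).
set_option synthInstance.maxHeartbeats 200000

namespace Literature.MathematicalPhysics.QuantumFieldTheory

variable {d : ℕ} [NeZero d]

section SchwingerFamily
open Literature.MathematicalPhysics.QuantumLattice (SchwingerFamily)
open Literature.MathematicalPhysics.QuantumLattice.SchwingerFamily
open Literature.MathematicalPhysics.QuantumLattice.SchwingerFamily.OSSpace
open Literature.Analysis.OperatorTheory

variable (𝔖 : SchwingerFamily (EuclideanSpace ℝ (Fin d))) (hE1 : 𝔖.IsEuclideanCovariant)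
  (hE2 : 𝔖.IsOSReflectionPositive)

/-- **The analytic continuation of the Schwinger function across one time gap**
(Osterwalder–Schrader I (1973), (4.10); II (1975), (5.4)): for generators `p = (n, F)`,
`q = (m, G)` (positive-time test functions), `τ ↦ ⟪v(F), e^{-τH} v(G)⟫` with the holomorphic
semigroup `e^{-τH} = holoShiftH hE1 τ` on the OS Hilbert space. For real `τ = t ≥ 0` this is
`𝔖_{n+m}(ΘF* ⊗ G_t)` (`gapContinuation_ofReal`). [cite: OsterwalderSchraderCMP1973, §4.1 eq. (4.10), p. 92] -/
def _root_.Literature.MathematicalPhysics.QuantumLattice.SchwingerFamily.gapContinuation (p q : PosGen d) (τ : ℂ) : ℂ :=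
  ⟪ι 𝔖 hE2 (δ 𝔖 hE2 p), holoShiftH (hE2 := hE2) hE1 τ (ι 𝔖 hE2 (δ 𝔖 hE2 q))⟫_ℂ

variable {𝔖 hE1 hE2}

/-- Time translation of a basis vector: `T(t) δ_q = δ_{q_t}`. [folklore] -/
theorem _root_.Literature.MathematicalPhysics.QuantumLattice.SchwingerFamily.OSSpace.shiftOp_δ (t : ℝ) (q : PosGen d) :
    shiftOp 𝔖 hE2 t (δ 𝔖 hE2 q) = δ 𝔖 hE2 (shiftGen t q) := by
  rw [δ, shiftOp_of, Finsupp.mapDomain_single]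
  rfl

/-- **On the nonnegative real axis the continuation is the Schwinger function across the gap**:
`gapContinuation p q t = 𝔖_{n+m}(ΘF* ⊗ G_t) = genPairing 𝔖 p (shiftGen t q)` for `t ≥ 0`
(`e^{-tH} v(G) = v(G_t)`, OS II (5.3)). [cite: OsterwalderSchraderCMP1975, Ch. V eqs. (5.3)–(5.4), p. 291] -/
theorem _root_.Literature.MathematicalPhysics.QuantumLattice.SchwingerFamily.gapContinuation_ofReal (p q : PosGen d) {t : ℝ} (ht : 0 ≤ t) :
    gapContinuation 𝔖 hE1 hE2 p q t = genPairing 𝔖 p (shiftGen t q) := by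
  unfold gapContinuation
  rcases ht.eq_or_lt with rfl | hpos
  · rw [Complex.ofReal_zero, holoShiftH_zero hE1, one_apply_eq_self, inner_ι_ι, inner_δ_δ, shiftGen_zero]
  · rw [holoShiftH_ofReal hE1 hpos, shiftH_ι hE1, inner_ι_ι, shiftOp_δ, inner_δ_δ]

/-- **Holomorphy in the gap variable**: `τ ↦ ⟪v(F), e^{-τH} v(G)⟫` is holomorphic on
`{Re τ > 0}` (Osterwalder–Schrader II (1975), (5.4): "an analytic function of the variable `z`
… for `Re z > 0`"). [cite: OsterwalderSchraderCMP1975, Ch. V eq. (5.4), p. 291] -/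
theorem _root_.Literature.MathematicalPhysics.QuantumLattice.SchwingerFamily.differentiableOn_gapContinuation (p q : PosGen d) :
    DifferentiableOn ℂ (gapContinuation 𝔖 hE1 hE2 p q) {τ : ℂ | 0 < τ.re} :=
  differentiableOn_inner_holoShiftH hE1 _ _

/-- **Continuity up to the imaginary axis** (real Minkowski times): `τ ↦ ⟪v(F), e^{-τH} v(G)⟫` is
continuous on `{Re τ ≥ 0}`. [cite: OsterwalderSchraderCMP1973, §4.1 p. 92] -/
theorem _root_.Literature.MathematicalPhysics.QuantumLattice.SchwingerFamily.continuousOn_gapContinuation (p q : PosGen d) :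
    ContinuousOn (gapContinuation 𝔖 hE1 hE2 p q) {τ : ℂ | 0 ≤ τ.re} :=
  continuousOn_inner_holoShiftH hE1 _ _

/-- **Uniform bound** `|⟪v(F), e^{-τH} v(G)⟫| ≤ ‖v(F)‖ ‖v(G)‖` on `{Re τ ≥ 0}` (contraction
property of `e^{-τH}`; Osterwalder–Schrader I (1973), p. 92, "uniformly bounded"), with
`‖v(F)‖² = 𝔖_{2n}(ΘF* ⊗ F)`. [cite: OsterwalderSchraderCMP1973, §4.1 p. 92] -/
theorem _root_.Literature.MathematicalPhysics.QuantumLattice.SchwingerFamily.norm_gapContinuation_le (p q : PosGen d) {τ : ℂ} (hτ : 0 ≤ τ.re) :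
    ‖gapContinuation 𝔖 hE1 hE2 p q τ‖ ≤ ‖δ 𝔖 hE2 p‖ * ‖δ 𝔖 hE2 q‖ := by
  unfold gapContinuation
  refine (norm_inner_le_norm _ _).trans ?_
  rw [norm_ι]
  gcongr
  exact (norm_holoShiftH_apply_le hE1 hτ _).trans (le_of_eq (norm_ι _))

/-- The bound in terms of Schwinger functions: `‖v(F)‖² = Re 𝔖_{2n}(ΘF* ⊗ F)`. [folklore] -/
theorem _root_.Literature.MathematicalPhysics.QuantumLattice.SchwingerFamily.norm_δ_sq (p : PosGen d) :
    ‖δ 𝔖 hE2 p‖ ^ 2 = RCLike.re (genPairing 𝔖 p p) := by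
  rw [← inner_self_eq_norm_sq (𝕜 := ℂ), inner_δ_δ]

/-- **The Schwinger function across a gap is the boundary value of a bounded holomorphic
function**: summary of the above in the form used for the continuation to real times —
there is `Φ` holomorphic on `{Re τ > 0}`, continuous on `{Re τ ≥ 0}`, bounded there by
`(𝔖_{2n}(ΘF* ⊗ F) 𝔖_{2m}(ΘG* ⊗ G))^{1/2}`, with `Φ(t) = 𝔖_{n+m}(ΘF* ⊗ G_t)` for `t ≥ 0`
(Osterwalder–Schrader I (1973), §4.1, (4.10)–(4.11)). [cite: OsterwalderSchraderCMP1973, §4.1 eqs. (4.10)–(4.11), pp. 92–93] -/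
theorem _root_.Literature.MathematicalPhysics.QuantumLattice.SchwingerFamily.exists_gap_continuation (hE1 : 𝔖.IsEuclideanCovariant)
    (hE2 : 𝔖.IsOSReflectionPositive) (p q : PosGen d) :
    ∃ Φ : ℂ → ℂ, DifferentiableOn ℂ Φ {τ : ℂ | 0 < τ.re} ∧ ContinuousOn Φ {τ : ℂ | 0 ≤ τ.re} ∧
      (∀ τ : ℂ, 0 ≤ τ.re → ‖Φ τ‖ ^ 2 ≤ RCLike.re (genPairing 𝔖 p p) * RCLike.re (genPairing 𝔖 q q)) ∧
      ∀ t : ℝ, 0 ≤ t → Φ t = genPairing 𝔖 p (shiftGen t q) := by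
  refine ⟨gapContinuation 𝔖 hE1 hE2 p q, differentiableOn_gapContinuation p q,
    continuousOn_gapContinuation p q, fun τ hτ => ?_, fun t ht => gapContinuation_ofReal p q ht⟩
  rw [← norm_δ_sq, ← norm_δ_sq, ← mul_pow]
  exact pow_le_pow_left₀ (norm_nonneg _) (norm_gapContinuation_le p q hτ) 2

end SchwingerFamily

end Literature.MathematicalPhysics.QuantumFieldTheory
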